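/-
Origin: expansion seat `planner-pub-hodgecm-pv10-0`, handover 2026-08-18 (`HOME/pub-hodgecm-pv10/lean/Pv10/TensorIntersection.lean`, md5 ab17928f, 71 lines);
landed by the gen-6 packager in gate run 22 as `HodgeCM/PerL34/TensorIntersection.lean` (verbatim).
-/
/-
Origin: planner-pub-hodgecm-pv10-0 (unit pub-hodgecm-pv10), HodgeCM publication cell, 2026-08-18.
Node N15 (PerL v5 §3.2, tex ll. 307–308): "the two prescriptions … are trivial on
`L^× ∩ 𝔸^×_{L₀} L^×_∞ = L₀^×`" — the ALGEBRAIC heart of the displayed equality: inside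
`L ⊗_{L₀} R` (R any nonzero commutative `L₀`-algebra, e.g. `L_{0,v}` or `𝔸_{L₀,f}`), `L ∩ R = L₀`.
KERNEL (two lines over Mathlib's linear disjointness).
-/
import Mathlib.RingTheory.LinearDisjoint
import Mathlib.RingTheory.Flat.Basic

/-!
# `L ∩ R = K` inside `L ⊗[K] R` (node N15, "`L^× ∩ 𝔸^×_{L₀}L^×_∞ = L₀^×`")

For a field `K` and commutative `K`-algebras `L`, `R` with `R` nonzero:

* `Algebra.TensorProduct.range_includeLeft_inf_range_includeRight`: the images of `L` and `R` in
  `L ⊗[K] R` meet in (the image of) `K`;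
* `Algebra.TensorProduct.exists_eq_algebraMap_of_tmul_one_eq_one_tmul`: if `x ⊗ 1 = 1 ⊗ y` then
  `x = algebraMap K L k` (and `y = algebraMap K R k`) for some `k : K`.

With `K = L₀`, `L` the CM field and `R = L_{0,v}` (one finite place suffices) this is the statement
that an element of `L` whose image in `L_v = L ⊗_{L₀} L_{0,v}` lies in `L_{0,v}` belongs to `L₀`, i.e.
`L ∩ 𝔸_{L₀} = L₀` once `𝔸_{L,f} = L ⊗_{L₀} 𝔸_{L₀,f}` (adelic base change — absent from Mathlib, so
the identification itself stays untyped).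
-/

set_option autoImplicit false

open scoped TensorProduct

namespace Algebra.TensorProduct

variable (K L R : Type*) [Field K] [CommRing L] [Algebra K L] [CommRing R] [Algebra K R]

/-- In `L ⊗[K] R` the images of `L` and of `R` intersect in the image of `K`. -/
theorem range_includeLeft_inf_range_includeRight :
    (includeLeft : L →ₐ[K] L ⊗[K] R).range ⊓ (includeRight : R →ₐ[K] L ⊗[K] R).range = ⊥ :=
  (Subalgebra.LinearDisjoint.include_range K L R).inf_eq_bot

variable {L R}

/-- **PerL ll. 307–308 (`L ∩ R = K`).**  If `x ⊗ 1 = 1 ⊗ y` in `L ⊗[K] R` with `R ≠ 0`, then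
`x` comes from `K`. -/
theorem exists_eq_algebraMap_of_tmul_one_eq_one_tmul [Nontrivial R] (x : L) (y : R)
    (h : x ⊗ₜ[K] (1 : R) = (1 : L) ⊗ₜ[K] y) :
    ∃ k : K, x = algebraMap K L k := by
  have hmem : x ⊗ₜ[K] (1 : R) ∈
      (includeLeft : L →ₐ[K] L ⊗[K] R).range ⊓ (includeRight : R →ₐ[K] L ⊗[K] R).range :=
    ⟨⟨x, rfl⟩, ⟨y, h.symm⟩⟩
  rw [range_includeLeft_inf_range_includeRight, Algebra.mem_bot] at hmem
  obtain ⟨k, hk⟩ := hmem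
  refine ⟨k, includeLeft_injective (R := K) (S := K) (A := L) (B := R)
    (algebraMap K R).injective ?_⟩
  show includeLeft x = includeLeft (algebraMap K L k)
  rw [includeLeft_apply, includeLeft_apply, ← hk, algebraMap_apply]

/-- Symmetric version: `y` comes from `K` too (when `L ≠ 0`). -/
theorem exists_eq_algebraMap_of_tmul_one_eq_one_tmul' [Nontrivial L] (x : L) (y : R)
    (h : x ⊗ₜ[K] (1 : R) = (1 : L) ⊗ₜ[K] y) :
    ∃ k : K, y = algebraMap K R k := by
  have hmem : (1 : L) ⊗ₜ[K] y ∈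
      (includeLeft : L →ₐ[K] L ⊗[K] R).range ⊓ (includeRight : R →ₐ[K] L ⊗[K] R).range :=
    ⟨⟨x, h⟩, ⟨y, rfl⟩⟩
  rw [range_includeLeft_inf_range_includeRight, Algebra.mem_bot] at hmem
  obtain ⟨k, hk⟩ := hmem
  refine ⟨k, includeRight_injective (R := K) (A := L) (B := R)
    (algebraMap K L).injective ?_⟩
  show includeRight y = includeRight (algebraMap K R k)
  rw [includeRight_apply, includeRight_apply, ← hk, algebraMap_apply']

end Algebra.TensorProduct
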